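import Summits.Ventures.CertifiedArithmetic.Expansions.CompressLocality
import Summits.Ventures.CertifiedArithmetic.Expansions.CompressScaling
import Summits.Ventures.CertifiedArithmetic.Expansions.CompressWindowGeneric
import Mathlib.Tactic.Linarith
import Mathlib.Tactic.Positivity
import Mathlib.Tactic.Ring
import Mathlib.Tactic.NormNum

/-!
# The kink family at every precision `p ≥ 3`: one COMPRESS pass moves the kink one block down (new work)

New work of the certified-arithmetic venture (ENGINES group: shared numerical engines serving
client cells; rigour lives in the verifiers; every published number belongs to a client cell's
ledger, not to the engines group).  NOT a published theorem: Shewchuk [Shewchuk1997, §2.7] proves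
Theorem 23 about ONE pass of COMPRESS and says nothing about iterating it.  `CompressKinkFamily.lean`
exhibits, at precision `p = 3`, expansions of `2k + 4` components needing `k + 1` passes; this file
is its version at EVERY precision `p = q + 3 ≥ 3` (IEEE ties-to-even `roundTiesEven (q+3) emin`,
`emin ≤ 0`), built on the generic window of `CompressWindowGeneric.lean`.  With `h = 2^(p−1)` and
block ratio `2^(3p)`, the family is
`famG q k = ⟨h+1, −(h−1)·2^(2p−1)⟩·2^(3pj) (j < k) ++ ⟨−(h−1), −(h−1)·2^p, (3h/2+1)·2^(2p), −(h+1)·2^(4p)⟩·2^(3pk)`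
(smallest first: `k` PAIR BLOCKS, then the KINK and the summit; `q = 0` is `fam3 k`).

Mechanism (`compress_stateG_succ`), verbatim the `p = 3` one: by locality (`CompressLocality.lean`)
a pass acts only on the window formed by the top pair block and the kink, and by scale covariance
(`CompressScaling.lean`) that action is the certified generic computation `compress_windowG`: the
kink moves ONE BLOCK DOWN, leaving inert debris `⟨−(2h−1)·2^(4p−1), (3h/2+1)·2^(5p)⟩` behind;
everything else is an inert chain.  After `k` passes the kink sits at the bottom (`stateG q 0 k`),
pass `k + 1` turns `⟨−(h−1), −(h−1)·2^p, (3h/2+1)·2^(2p)⟩` into `⟨1, −(2h−1)·2^(p−1), (3h/2+1)·2^(2p)⟩`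
(`finalG q k`), which is fixed.  So at EVERY precision `p ≥ 3` the number of COMPRESS passes needed
to reach the fixed point is unbounded in the length of the expansion (count and legitimacy of the
inputs: `CompressPassesUnboundedGeneric.lean`).
-/

namespace Summit.Ventures.CertifiedArithmetic.Expansions

open Literature.ComputerArithmetic.JeannerodRump2018
open Literature.ComputerArithmetic.BoldoJeannerodMelquiondMuller2023 hiding twoSum twoSum_fst
open Literature.ComputerArithmetic.Shewchuk1997

variable {q : ℕ} {emin : ℤ}

/-! ### The family (`p = q + 3`, `h = 4·2^q`, block ratio `2^(3q+9) = 2^(3p)`) -/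

/-- A list of coefficients read in the binade `2^s`. -/
def scG (s : ℕ) (l : List ℚ) : List ℚ := l.map (· * (2 : ℚ) ^ s)

/-- `m` pair blocks `⟨h+1, −(h−1)·2^(2p−1)⟩·2^(3pj)`, `j < m`, smallest first. -/
def pairsG (q : ℕ) : ℕ → List ℚ
  | 0 => []
  | m + 1 => pairsG q m ++
      scG ((3 * q + 9) * m) [(4 * 2 ^ q + 1), -(4 * 2 ^ q - 1) * (32 * (2 ^ q) ^ 2)]

/-- The kink `⟨−(h−1), −(h−1)·2^p, (3h/2+1)·2^(2p)⟩·2^s`. -/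
def kinkG (q s : ℕ) : List ℚ :=
  scG s [-(4 * 2 ^ q - 1), -(4 * 2 ^ q - 1) * (8 * 2 ^ q), (6 * 2 ^ q + 1) * (64 * (2 ^ q) ^ 2)]

/-- `n` debris blocks `⟨−(2h−1)·2^(4p−1), (3h/2+1)·2^(5p)⟩·2^s, ·2^(s+3p), …`. -/
def debrisG (q : ℕ) : ℕ → ℕ → List ℚ
  | _, 0 => []
  | s, n + 1 => scG s [-(8 * 2 ^ q - 1) * (2048 * (2 ^ q) ^ 4), (6 * 2 ^ q + 1) * (32768 * (2 ^ q) ^ 5)]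
      ++ debrisG q (s + (3 * q + 9)) n

/-- The state with `m` pair blocks below the kink and `n` debris blocks above it, under the summit
`−(h+1)·2^(4p)·2^(3p(m+n))`. -/
def stateG (q m n : ℕ) : List ℚ :=
  pairsG q m ++ (kinkG q ((3 * q + 9) * m) ++ (debrisG q ((3 * q + 9) * m) n ++
    [-(4 * 2 ^ q + 1) * (4096 * (2 ^ q) ^ 4) * (2 : ℚ) ^ ((3 * q + 9) * (m + n))]))

/-- THE FAMILY at precision `q + 3`: `k` pair blocks, the kink, the summit — `2k + 4` components. -/
def famG (q k : ℕ) : List ℚ := stateG q k 0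

/-- The fixed point reached after `k + 1` passes. -/
def finalG (q n : ℕ) : List ℚ :=
  [1, -(8 * 2 ^ q - 1) * (4 * 2 ^ q), (6 * 2 ^ q + 1) * (64 * (2 ^ q) ^ 2)] ++
    (debrisG q 0 n ++ [-(4 * 2 ^ q + 1) * (4096 * (2 ^ q) ^ 4) * (2 : ℚ) ^ ((3 * q + 9) * n)])

/-- Reading the empty list in a binade gives the empty list. [cite: BoldoEtAl2023, §2.1] -/
@[simp] theorem scG_nil (s : ℕ) : scG s [] = [] := rfl
/-- `scG` scales the head and the tail. [cite: BoldoEtAl2023, §2.1] -/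
@[simp] theorem scG_cons (s : ℕ) (a : ℚ) (l : List ℚ) : scG s (a :: l) = a * 2 ^ s :: scG s l :=
  rfl

/-- The block ratio `2^(3p) = 2^(3q+9) = 512·(2^q)^3`. [cite: BoldoEtAl2023, §2.1] -/
theorem two_pow_blockG (q : ℕ) : (2 : ℚ) ^ (3 * q + 9) = 512 * (2 ^ q) ^ 3 := by
  rw [pow_add, pow_mul']; ring

/-- Exponent bookkeeping: `c·2^(s+j) = (c·2^j)·2^s`. [cite: BoldoEtAl2023, §2.1] -/
theorem sc_shiftG (c : ℚ) (s j : ℕ) : c * (2 : ℚ) ^ (s + j) = (c * 2 ^ j) * 2 ^ s := by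
  rw [pow_add]; ring

/-- `m` pair blocks have `2m` components. [cite: Shewchuk1997, §2.1 (expansion)] -/
theorem length_pairsG (q : ℕ) : ∀ m : ℕ, (pairsG q m).length = 2 * m
  | 0 => rfl
  | m + 1 => by
    rw [pairsG, List.length_append, length_pairsG q m]
    simp only [scG, List.length_map, List.length_cons, List.length_nil]
    omega

/-- `famG q k` has `2k + 4` components. -/
theorem length_famG (q k : ℕ) : (famG q k).length = 2 * k + 4 := by
  simp only [famG, stateG, kinkG, debrisG, scG, List.length_append, List.length_map,
    List.length_cons, List.length_nil, List.nil_append, length_pairsG]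

/-! ### Roundings and floats in the binade `2^s` -/

/-- A float read in the binade `2^s` is a float (`emin ≤ 0 ≤ s`). [cite: JeannerodRump2018, §1] -/
theorem isFloatG_sc (s : ℕ) {c : ℚ} (hc : IsFloat (q + 3) emin c) :
    IsFloat (q + 3) emin (c * 2 ^ s) := by
  obtain ⟨M, e, hM, hem, hce⟩ := hc
  exact ⟨M, e + s, hM, by omega,
    by rw [hce, zpow_add₀ (by norm_num : (2 : ℚ) ≠ 0), zpow_natCast]; ring⟩

section rounding
variable (he : emin ≤ 0)
include he

/-- A base rounding `RN_e^{p,em}(a) = r` (all `em ≤ 0`) read in the binade `2^s`.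
[cite: BoldoEtAl2023, §2.2] -/
theorem rnG_sc (s : ℕ) {a r : ℚ}
    (h : ∀ em : ℤ, em ≤ 0 → roundTiesEven (q + 3) em a = r) :
    roundTiesEven (q + 3) emin (a * 2 ^ s) = r * 2 ^ s := by
  rw [← zpow_natCast, roundTiesEven_mul_two_zpow, h _ (by omega)]

/-- An INERT pair in the binade `2^s`: from the base rounding `RN_e(cb + ca) = cb` and `ca` a
nonzero float, the pair `(ca·2^s, cb·2^s)` satisfies the replay relation of
`compress_eq_self_of_isChain`. [cite: Shewchuk1997, §2.7 p. 332; BoldoEtAl2023, §2.2] -/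
theorem inertG_sc (s : ℕ) {ca cb : ℚ}
    (hsum : ∀ em : ℤ, em ≤ 0 → roundTiesEven (q + 3) em (cb + ca) = cb)
    (ha : IsFloat (q + 3) emin ca) (ha0 : ca ≠ 0) :
    roundTiesEven (q + 3) emin (cb * 2 ^ s + ca * 2 ^ s) = cb * 2 ^ s ∧
      roundTiesEven (q + 3) emin (ca * 2 ^ s) = ca * 2 ^ s ∧ ca * 2 ^ s ≠ 0 :=
  ⟨by rw [← add_mul]; exact rnG_sc he s hsum,
    roundTiesEven_eq_self (by omega) (isFloatG_sc s ha),
    mul_ne_zero ha0 (pow_ne_zero _ (by norm_num))⟩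

/-- The floats of the family: pair `(h+1, −(h−1)·2^(2p−1))`, kink `(−(h−1), −(h−1)·2^p,
(3h/2+1)·2^(2p))`, debris `(−(2h−1)·2^(4p−1), (3h/2+1)·2^(5p))`, summit `−(h+1)·2^(4p)`, and the
final bottom `(1, −(2h−1)·2^(p−1))` — all `p`-bit floats. [cite: JeannerodRump2018, §1] -/
theorem famG_isFloat :
    IsFloat (q + 3) emin ((4 * 2 ^ q + 1) : ℚ) ∧
      IsFloat (q + 3) emin (-(4 * 2 ^ q - 1) * (32 * (2 ^ q) ^ 2) : ℚ) ∧
      IsFloat (q + 3) emin (-(4 * 2 ^ q - 1) : ℚ) ∧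
      IsFloat (q + 3) emin (-(4 * 2 ^ q - 1) * (8 * 2 ^ q) : ℚ) ∧
      IsFloat (q + 3) emin ((6 * 2 ^ q + 1) * (64 * (2 ^ q) ^ 2) : ℚ) ∧
      IsFloat (q + 3) emin (-(8 * 2 ^ q - 1) * (2048 * (2 ^ q) ^ 4) : ℚ) ∧
      IsFloat (q + 3) emin ((6 * 2 ^ q + 1) * (32768 * (2 ^ q) ^ 5) : ℚ) ∧
      IsFloat (q + 3) emin (-(4 * 2 ^ q + 1) * (4096 * (2 ^ q) ^ 4) : ℚ) ∧
      IsFloat (q + 3) emin (1 : ℚ) ∧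
      IsFloat (q + 3) emin (-(8 * 2 ^ q - 1) * (4 * 2 ^ q) : ℚ) := by
  obtain ⟨hk2, -, -, hb, ha, -, -, hd, -, -, hm0, hm1, hm2, hf1, h1, hS, -⟩ :=
    windowG_isFloat (q := q) he
  exact ⟨ha, hb, hm0, hm1, hm2, hd, hk2, hS, h1, hf1⟩

end rounding

/-- The junction lows are nonzero: `h+1`, `−(h−1)·2^(2p−1)`, `(3h/2+1)·2^(2p)`,
`−(2h−1)·2^(4p−1)`. [cite: BoldoEtAl2023, §2.1] -/
theorem famG_ne_zero (q : ℕ) : ((4 * 2 ^ q + 1) : ℚ) ≠ 0 ∧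
    (-(4 * 2 ^ q - 1) * (32 * (2 ^ q) ^ 2) : ℚ) ≠ 0 ∧
    ((6 * 2 ^ q + 1) * (64 * (2 ^ q) ^ 2) : ℚ) ≠ 0 ∧
    (-(8 * 2 ^ q - 1) * (2048 * (2 ^ q) ^ 4) : ℚ) ≠ 0 := by
  have h1 : (1 : ℚ) ≤ 2 ^ q := (yfactsG q).1
  exact ⟨by positivity, (mul_neg_of_neg_of_pos (by linarith) (by positivity)).ne,
    by positivity, (mul_neg_of_neg_of_pos (by linarith) (by positivity)).ne⟩

section chains
variable (he : emin ≤ 0)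
include he

/-! ### The inert chains below and above the window -/

/-- The pair blocks form a chain continuing into anything chained onto the top block (junctions
`RN(−(h−1)·2^(2p−1) + (h+1)) = −(h−1)·2^(2p−1)` inside a block and
`RN((h+1)·2^(3p) − (h−1)·2^(2p−1)) = (h+1)·2^(3p)` between blocks).
[cite: Shewchuk1997, §2.7 p. 332 (COMPRESS)] -/
theorem isChain_pairsG : ∀ (m : ℕ) (l : List ℚ),
    List.IsChain (fun a b => roundTiesEven (q + 3) emin (b + a) = b ∧
      roundTiesEven (q + 3) emin a = a ∧ a ≠ 0)
      (scG ((3 * q + 9) * m) [(4 * 2 ^ q + 1), -(4 * 2 ^ q - 1) * (32 * (2 ^ q) ^ 2)] ++ l) →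
    List.IsChain (fun a b => roundTiesEven (q + 3) emin (b + a) = b ∧
      roundTiesEven (q + 3) emin a = a ∧ a ≠ 0) (pairsG q (m + 1) ++ l)
  | 0, l, h => by simpa [pairsG] using h
  | m + 1, l, h => by
    obtain ⟨ha, hb, -⟩ := famG_isFloat (q := q) he
    obtain ⟨ha0, hb0, -⟩ := famG_ne_zero q
    rw [pairsG, List.append_assoc]
    apply isChain_pairsG m
    simp only [scG_cons, scG_nil, List.cons_append, List.nil_append] at h ⊢
    refine List.IsChain.cons_cons (inertG_sc he _ (fun em hem => rneG_b_a (q := q) hem) ha ha0)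
      (List.IsChain.cons_cons ?_ h)
    have e : ((4 * 2 ^ q + 1) : ℚ) * 2 ^ ((3 * q + 9) * (m + 1)) =
        (4 * 2 ^ q + 1) * (512 * (2 ^ q) ^ 3) * 2 ^ ((3 * q + 9) * m) := by
      rw [show (3 * q + 9) * (m + 1) = (3 * q + 9) * m + (3 * q + 9) by ring, sc_shiftG,
        two_pow_blockG]
    rw [e]
    exact inertG_sc he _ (fun em hem => rneG_a3_b (q := q) hem) hb hb0

/-- Debris blocks and the summit above a kink top `(3h/2+1)·2^(2p)·2^s` form a chain (junctions
`RN(−(2h−1)·2^(4p−1) + (3h/2+1)·2^(2p))`, `RN((3h/2+1)·2^(5p) − (2h−1)·2^(4p−1))`,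
`RN(−(h+1)·2^(4p) + (3h/2+1)·2^(2p))`, each returning its first argument).
[cite: Shewchuk1997, §2.7 p. 332 (COMPRESS)] -/
theorem isChain_debrisG : ∀ (n s : ℕ),
    List.IsChain (fun a b => roundTiesEven (q + 3) emin (b + a) = b ∧
      roundTiesEven (q + 3) emin a = a ∧ a ≠ 0)
      ((6 * 2 ^ q + 1) * (64 * (2 ^ q) ^ 2) * 2 ^ s :: (debrisG q s n ++
        [-(4 * 2 ^ q + 1) * (4096 * (2 ^ q) ^ 4) * (2 : ℚ) ^ (s + (3 * q + 9) * n)]))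
  | 0, s => by
    obtain ⟨-, -, -, -, hm2, -⟩ := famG_isFloat (q := q) he
    obtain ⟨-, -, hm20, -⟩ := famG_ne_zero q
    simp only [debrisG, List.nil_append, mul_zero, add_zero]
    exact List.IsChain.cons_cons (inertG_sc he s (fun em hem => rneG_S_m2 (q := q) hem) hm2 hm20)
      (List.isChain_singleton _)
  | n + 1, s => by
    obtain ⟨-, -, -, -, hm2, hd, -⟩ := famG_isFloat (q := q) he
    obtain ⟨-, -, hm20, hd0⟩ := famG_ne_zero q
    rw [debrisG]
    simp only [scG_cons, scG_nil, List.cons_append, List.nil_append]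
    refine List.IsChain.cons_cons (inertG_sc he s (fun em hem => rneG_d_m2 (q := q) hem) hm2 hm20)
      (List.IsChain.cons_cons (inertG_sc he s (fun em hem => rneG_k2_d (q := q) hem) hd hd0) ?_)
    have ih := isChain_debrisG n (s + (3 * q + 9))
    have e1 : ((6 * 2 ^ q + 1) * (64 * (2 ^ q) ^ 2) : ℚ) * 2 ^ (s + (3 * q + 9)) =
        (6 * 2 ^ q + 1) * (32768 * (2 ^ q) ^ 5) * 2 ^ s := by
      rw [sc_shiftG, two_pow_blockG]; ring
    have e2 : s + (3 * q + 9) + (3 * q + 9) * n = s + (3 * q + 9) * (n + 1) := by ring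
    rwa [e1, e2] at ih

end chains

/-! ### One pass = the window moves one block down -/

section passes
variable (he : emin ≤ 0)
include he

/-- The generic window pass read in the binade `2^s`. [cite: Shewchuk1997, §2.7 p. 332 (COMPRESS)] -/
theorem compress_windowG_sc (s : ℕ) :
    compress (roundTiesEven (q + 3) emin)
        (scG s [(4 * 2 ^ q + 1), -(4 * 2 ^ q - 1) * (32 * (2 ^ q) ^ 2),
          -(4 * 2 ^ q - 1) * (512 * (2 ^ q) ^ 3), -(4 * 2 ^ q - 1) * (4096 * (2 ^ q) ^ 4)] ++
          [(6 * 2 ^ q + 1) * (32768 * (2 ^ q) ^ 5) * 2 ^ s]) =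
      scG s [-(4 * 2 ^ q - 1), -(4 * 2 ^ q - 1) * (8 * 2 ^ q), (6 * 2 ^ q + 1) * (64 * (2 ^ q) ^ 2),
          -(8 * 2 ^ q - 1) * (2048 * (2 ^ q) ^ 4)] ++
        [(6 * 2 ^ q + 1) * (32768 * (2 ^ q) ^ 5) * 2 ^ s] := by
  have h := compress_map_mul_two_zpow (q + 3) emin s
    [(4 * 2 ^ q + 1), -(4 * 2 ^ q - 1) * (32 * (2 ^ q) ^ 2), -(4 * 2 ^ q - 1) * (512 * (2 ^ q) ^ 3),
      -(4 * 2 ^ q - 1) * (4096 * (2 ^ q) ^ 4), (6 * 2 ^ q + 1) * (32768 * (2 ^ q) ^ 5)]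
  rw [compress_windowG (q := q) (em := emin - s) (by omega)] at h
  simpa [scG, zpow_natCast] using h

/-- … and its downward sweep ends with the carry `−(h−1)·2^s`.
[cite: Shewchuk1997, §2.7 p. 332 (COMPRESS), Lines 1–9] -/
theorem compressDown_windowG_sc (s : ℕ) :
    (compressDown (roundTiesEven (q + 3) emin) ((6 * 2 ^ q + 1) * (32768 * (2 ^ q) ^ 5) * 2 ^ s)
      (scG s [(4 * 2 ^ q + 1), -(4 * 2 ^ q - 1) * (32 * (2 ^ q) ^ 2),
          -(4 * 2 ^ q - 1) * (512 * (2 ^ q) ^ 3), -(4 * 2 ^ q - 1) * (4096 * (2 ^ q) ^ 4)]).reverse).2 =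
      -(4 * 2 ^ q - 1) * 2 ^ s := by
  have h := compressDown_mul_two_zpow_snd (q + 3) emin s ((6 * 2 ^ q + 1) * (32768 * (2 ^ q) ^ 5))
    [-(4 * 2 ^ q - 1) * (4096 * (2 ^ q) ^ 4), -(4 * 2 ^ q - 1) * (512 * (2 ^ q) ^ 3),
      -(4 * 2 ^ q - 1) * (32 * (2 ^ q) ^ 2), (4 * 2 ^ q + 1)]
  rw [compressDown_windowG (q := q) (em := emin - s) (by omega)] at h
  simpa [scG, zpow_natCast] using h

/-- **One pass**: with `m + 1` pair blocks below the kink, COMPRESS moves the kink one block down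
and leaves one more debris block — at every precision `q + 3`.
[cite: Shewchuk1997, §2.7 p. 332 (COMPRESS)] -/
theorem compress_stateG_succ (m n : ℕ) :
    compress (roundTiesEven (q + 3) emin) (stateG q (m + 1) n) = stateG q m (n + 1) := by
  have h0 : roundTiesEven (q + 3) emin 0 = 0 := fl_zero (isRoundNearest_roundTiesEven (by omega))
  obtain ⟨ha, hb, -⟩ := famG_isFloat (q := q) he
  obtain ⟨ha0, hb0, -⟩ := famG_ne_zero q
  set s : ℕ := (3 * q + 9) * m with hs_def
  -- the state, cut as `low ++ (midrest ++ [M]) ++ high`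
  have e9 : (3 * q + 9) * (m + 1) = s + (3 * q + 9) := by rw [hs_def]; ring
  have etop : (3 * q + 9) * (m + 1 + n) = (s + (3 * q + 9)) + (3 * q + 9) * n := by
    rw [hs_def]; ring
  have etop' : (3 * q + 9) * (m + (n + 1)) = (s + (3 * q + 9)) + (3 * q + 9) * n := by
    rw [hs_def]; ring
  have ek0 : (-(4 * 2 ^ q - 1) : ℚ) * 2 ^ (s + (3 * q + 9)) =
      -(4 * 2 ^ q - 1) * (512 * (2 ^ q) ^ 3) * 2 ^ s := by
    rw [sc_shiftG, two_pow_blockG]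
  have ek1 : (-(4 * 2 ^ q - 1) * (8 * 2 ^ q) : ℚ) * 2 ^ (s + (3 * q + 9)) =
      -(4 * 2 ^ q - 1) * (4096 * (2 ^ q) ^ 4) * 2 ^ s := by
    rw [sc_shiftG, two_pow_blockG]; ring
  have ek2 : ((6 * 2 ^ q + 1) * (64 * (2 ^ q) ^ 2) : ℚ) * 2 ^ (s + (3 * q + 9)) =
      (6 * 2 ^ q + 1) * (32768 * (2 ^ q) ^ 5) * 2 ^ s := by
    rw [sc_shiftG, two_pow_blockG]; ring
  have hstate : stateG q (m + 1) n = pairsG q m ++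
      (scG s [(4 * 2 ^ q + 1), -(4 * 2 ^ q - 1) * (32 * (2 ^ q) ^ 2),
          -(4 * 2 ^ q - 1) * (512 * (2 ^ q) ^ 3), -(4 * 2 ^ q - 1) * (4096 * (2 ^ q) ^ 4)] ++
        [(6 * 2 ^ q + 1) * (32768 * (2 ^ q) ^ 5) * 2 ^ s]) ++
      (debrisG q (s + (3 * q + 9)) n ++
        [-(4 * 2 ^ q + 1) * (4096 * (2 ^ q) ^ 4) * (2 : ℚ) ^ ((s + (3 * q + 9)) + (3 * q + 9) * n)]) := by
    simp only [stateG, pairsG, kinkG, e9, etop, ← hs_def, scG_cons, scG_nil, ek0, ek1, ek2,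
      List.append_assoc, List.cons_append, List.nil_append]
  have hstate' : stateG q m (n + 1) = pairsG q m ++
      (scG s [-(4 * 2 ^ q - 1), -(4 * 2 ^ q - 1) * (8 * 2 ^ q), (6 * 2 ^ q + 1) * (64 * (2 ^ q) ^ 2),
          -(8 * 2 ^ q - 1) * (2048 * (2 ^ q) ^ 4)] ++
        [(6 * 2 ^ q + 1) * (32768 * (2 ^ q) ^ 5) * 2 ^ s]) ++
      (debrisG q (s + (3 * q + 9)) n ++
        [-(4 * 2 ^ q + 1) * (4096 * (2 ^ q) ^ 4) * (2 : ℚ) ^ ((s + (3 * q + 9)) + (3 * q + 9) * n)]) := by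
    simp only [stateG, kinkG, debrisG, etop', ← hs_def, scG_cons, scG_nil, List.append_assoc,
      List.cons_append, List.nil_append]
  -- below: the pair blocks, inert against the new kink bottom `−(h−1)·2^s`
  have hlow : List.IsChain
      (fun a b => roundTiesEven (q + 3) emin (b + a) = b ∧ roundTiesEven (q + 3) emin a = a ∧ a ≠ 0)
      (pairsG q m ++ [(compressDown (roundTiesEven (q + 3) emin)
        ((6 * 2 ^ q + 1) * (32768 * (2 ^ q) ^ 5) * 2 ^ s)
        (scG s [(4 * 2 ^ q + 1), -(4 * 2 ^ q - 1) * (32 * (2 ^ q) ^ 2),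
          -(4 * 2 ^ q - 1) * (512 * (2 ^ q) ^ 3), -(4 * 2 ^ q - 1) * (4096 * (2 ^ q) ^ 4)]).reverse).2]) := by
    rw [compressDown_windowG_sc he s]
    cases m with
    | zero => simp [pairsG]
    | succ m' =>
      apply isChain_pairsG he m'
      have e : (-(4 * 2 ^ q - 1) : ℚ) * 2 ^ s = -(4 * 2 ^ q - 1) * (512 * (2 ^ q) ^ 3) *
          2 ^ ((3 * q + 9) * m') := by
        rw [hs_def, show (3 * q + 9) * (m' + 1) = (3 * q + 9) * m' + (3 * q + 9) by ring, sc_shiftG,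
          two_pow_blockG]
      simp only [scG_cons, scG_nil, List.cons_append, List.nil_append, e]
      exact List.IsChain.cons_cons (inertG_sc he _ (fun em hem => rneG_b_a (q := q) hem) ha ha0)
        (List.IsChain.cons_cons (inertG_sc he _ (fun em hem => rneG_k0_b (q := q) hem) hb hb0)
        (List.isChain_singleton _))
  -- above: debris and summit, inert against the window top `(3h/2+1)·2^(5p)·2^s = (3h/2+1)·2^(2p)·2^(s+3p)`
  have hhigh : List.IsChain
      (fun a b => roundTiesEven (q + 3) emin (b + a) = b ∧ roundTiesEven (q + 3) emin a = a ∧ a ≠ 0)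
      ((6 * 2 ^ q + 1) * (32768 * (2 ^ q) ^ 5) * 2 ^ s :: (debrisG q (s + (3 * q + 9)) n ++
        [-(4 * 2 ^ q + 1) * (4096 * (2 ^ q) ^ 4) * (2 : ℚ) ^ ((s + (3 * q + 9)) + (3 * q + 9) * n)])) := by
    have ih := isChain_debrisG (q := q) he n (s + (3 * q + 9))
    rwa [ek2] at ih
  rw [hstate, compress_append3_of_isChain h0 hlow (compress_windowG_sc he s) hhigh hhigh,
    compress_windowG_sc he s, hstate']

/-- **The last pass**: with the kink at the bottom, COMPRESS turns `⟨−(h−1), −(h−1)·2^p, (3h/2+1)·2^(2p)⟩`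
into `⟨1, −(2h−1)·2^(p−1), (3h/2+1)·2^(2p)⟩`. [cite: Shewchuk1997, §2.7 p. 332 (COMPRESS)] -/
theorem compress_stateG_zero (n : ℕ) :
    compress (roundTiesEven (q + 3) emin) (stateG q 0 n) = finalG q n := by
  have h0 : roundTiesEven (q + 3) emin 0 = 0 := fl_zero (isRoundNearest_roundTiesEven (by omega))
  have hhigh := isChain_debrisG (q := q) he n 0
  simp only [pow_zero, mul_one, zero_add] at hhigh
  have hst : stateG q 0 n = ([-(4 * 2 ^ q - 1), -(4 * 2 ^ q - 1) * (8 * 2 ^ q)] ++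
      [(6 * 2 ^ q + 1) * (64 * (2 ^ q) ^ 2)]) ++ (debrisG q 0 n ++
        [-(4 * 2 ^ q + 1) * (4096 * (2 ^ q) ^ 4) * (2 : ℚ) ^ ((3 * q + 9) * n)]) := by
    simp [stateG, pairsG, kinkG]
  have hys : compress (roundTiesEven (q + 3) emin)
      ([-(4 * 2 ^ q - 1), -(4 * 2 ^ q - 1) * (8 * 2 ^ q)] ++ [(6 * 2 ^ q + 1) * (64 * (2 ^ q) ^ 2)]) =
      [1, -(8 * 2 ^ q - 1) * (4 * 2 ^ q)] ++ [(6 * 2 ^ q + 1) * (64 * (2 ^ q) ^ 2)] := by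
    simpa using compress_kinkG (q := q) he
  rw [hst, compress_append_of_isChain_right h0 hys hhigh hhigh, hys]
  simp [finalG]

/-- … and the result is fixed. [cite: Shewchuk1997, §2.7 p. 332 (COMPRESS)] -/
theorem compress_finalG (n : ℕ) :
    compress (roundTiesEven (q + 3) emin) (finalG q n) = finalG q n := by
  have h0 : roundTiesEven (q + 3) emin 0 = 0 := fl_zero (isRoundNearest_roundTiesEven (by omega))
  have hhigh := isChain_debrisG (q := q) he n 0
  simp only [pow_zero, mul_one, zero_add] at hhigh
  have hst : finalG q n = ([1, -(8 * 2 ^ q - 1) * (4 * 2 ^ q)] ++ [(6 * 2 ^ q + 1) * (64 * (2 ^ q) ^ 2)]) ++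
      (debrisG q 0 n ++ [-(4 * 2 ^ q + 1) * (4096 * (2 ^ q) ^ 4) * (2 : ℚ) ^ ((3 * q + 9) * n)]) := by
    simp [finalG]
  have hys : compress (roundTiesEven (q + 3) emin)
      ([1, -(8 * 2 ^ q - 1) * (4 * 2 ^ q)] ++ [(6 * 2 ^ q + 1) * (64 * (2 ^ q) ^ 2)]) =
      [1, -(8 * 2 ^ q - 1) * (4 * 2 ^ q)] ++ [(6 * 2 ^ q + 1) * (64 * (2 ^ q) ^ 2)] := by
    simpa using compress_kinkG_final (q := q) he
  rw [hst, compress_append_of_isChain_right h0 hys hhigh hhigh, hys]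

end passes

/-- `q = 0`: the generic family is the `p = 3` family of `CompressKinkFamily.lean` —
`famG 0 1 = [5, −3·2^5, −3·2^9, −3·2^12, 7·2^15, −5·2^21] = fam3 1`. [cite: Shewchuk1997, §2.7] -/
theorem famG_zero_one : famG 0 1 = [5, -96, -1536, -12288, 229376, -10485760] := by
  norm_num [famG, stateG, pairsG, kinkG, debrisG, scG]

end Summit.Ventures.CertifiedArithmetic.Expansions
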